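import Summits.QuantumFields.BalabanUV.Beta.FP.MixLoopInstanceBlockFamily
import Summits.QuantumFields.BalabanUV.Beta.FP.AveragingJetLettersRootedSecond
import Summits.QuantumFields.BalabanUV.Beta.FP.MixLoopPowerCountingMassQuartic

/-!
# `Beta/FP/MixLoopInstanceBlockFamilyQuartic` — road «FP» (binder row D1), row **RHOA-6e (INST-MIX4)** «THE MIX-4 ENGINE AT THE ROOTED BLOCK FAMILY AND THE
# LATTICE COLUMNS»: RHOA-6c′'s mass-currency (MIX-4) engine `MixLoopPowerCountingMassQuartic.coarse_mix4_secondMoment_le` (`tr(Q̈·𝓘)`) INSTANTIATED with the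
# SECOND-jet kernel `ker₂ (blkW N p) (blkFld N μ u) (blkBg N μ u rad id)` of RHOA-6b′'s rooted block families (`AveragingJetLettersRootedSecond`), the pair weight
# `(1 + ‖b′−b‖∞²∕N²)` PAID BY THE SUPPORT (both letters sit in ONE word of block `u`), the windowed pair-mass letter (M₂) of `blk_windowedMass₂_le_half`, and the legs
# pinned to the perfect lattice columns `N⁴ • colOf (KPerf …)` — every power of `N = Lc^m` DISPLAYED ([folklore] index plumbing on `ℤ⁴`; no road object identified)

HONEST FRAMING (cell `pub-balaban`, β sub-cell, verbatim): discharging `BetaPertH` makes Bałaban's UV stability UNCONDITIONAL — a real constructive-QFT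
result; it is NOT the continuum limit and NOT the Clay problem.  THIS MODULE is [folklore] finite-sum plumbing composed BY NAME with ACCEPTED road theorems:
`MixLoopPowerCountingMassQuartic.coarse_mix4_secondMoment_le` (t4-ne7b-formalise-leaf-01-g23, RHOA-6c′), `AveragingJetLettersRootedSecond.{exists_of_ker₂_ne_zero,
ker₂_nonneg, blk_windowedMass₂_le_half}` (t4-ne7b-formalise-leaf-02-g22, RHOA-6b′ second jet), `MixLoopInstanceBlockFamily.{supNorm_pt_le_two_mul,
latticeColumn_engineLetters}` (p247290).  It asserts nothing about Bałaban's objects, cites nothing, mints no `Prop` fact, has no `def`, 0 sorry.  NOT `Mix_n = O(1)`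
(instance number `Σ_σ p σ` vs `N` = KER-γ (γ); the four-direction sum and the (rem)-piece packaging = the owner's LEDGER), NOT hbook, NOT D1, NOT BetaPertH,
NOT continuum, NOT Clay.  HONEST DEPENDENCY: continuum YM on T⁴ ⇐ BetaPertH ∧ nine spine estimates (0/9 proved); BetaPertH ⇐ (D1) ∧ (D4) ∧ CAP+tail;
G-an2-4 gates asym, D1 and NE2/3/4.

ABSOLUTE RULE (cell charter, verbatim): «No internally-minted statement may enter as a cited fact. Every hypothesis is either kernel-proved in this package or a
verbatim quotation of a PUBLISHED theorem with page reference. The manuscript(s) under audit are NOT citable for their own disputed steps — they are the thing under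
adjudication; programme-internal (2001/route/tribunal) claims are never citable.»

THE SHAPE (t4-ne7b-formalise-leaf-01-g24's INTENT O-ne7bleaf01g24-1, journal 2026-08-21T03:41:42Z, verbatim up to notation; owner «(MIX-4) stays with leaf-01's offer»
2026-08-21T04:00:44Z; filed by leaf-02-g23 on the journal ASK of 04:36Z): «instantiate `coarse_mix4_secondMoment_le` per coarse direction `μ` with
`qdd u b b′ c := ker₂ (blkW N p) (blkFld N μ u) (blkBg N μ u rad strB) b b′ c` …, (M₂) := (1 + 4R₀²)·[`blk_windowedMass₂_le_half`] via the NEW pair-support lemma (a nonzero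
`ker₂^{(u)} b b′ c` puts BOTH letters `b, b′` in one word `blkBg … e` of block `u`, hence within `R₀N` of `N•u`, so `‖b′−b‖∞ ≤ 2R₀N` and `(1 + ‖b′−b‖²∕N²) ≤ 1 + 4R₀²`)
⟹ `mix4_rem_blockFamily`: `≤ 3·(C N⁻¹)·(C N⁻¹ A(κ₀))·(1 + 16∕(κ₀∕4)²)·(C N⁻¹)·(1 + 4R₀²)·A_{M₂}` with `A_{M₂} = 2(ℓ₀+N)·((ℓ₀+N)·Σp)·e^{(κ₀∕4)R₀∕2}·(e^{(κ₀∕4)∕2}(1 + 480e^{(κ₀∕4)∕4}(4∕(κ₀∕4))⁴))`,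
EVERY power of `N` displayed — i.e. `≍ N⁻³·(ℓ₀+N)²·Σp`.»
CURRENCY: as in `MixLoopInstanceBlockFamily` (labels = points, `strB = id`; `rad`, `p`, `ℓ₀`, `R₀ ≥ 2` FREE with their displayed letters).  The (MIX-4) engine carries
NEITHER a coarse-radius NOR an offset letter, so `U b` and `W` are ARBITRARY finite sets with no filtering at all.
CONTENT.  §1 `mem_blkBg_local` (every letter of a word of block `u` lies within `R₀·N` of `N•u`), **`blk_ker₂_pair_local`** (a nonzero `ker₂^{(u)} b b′ c` puts `b` AND `b′`
within `R₀N` of `N•u`), **`pairWeight_le_of_ker₂_ne_zero`** (`1 + (‖b′−b‖∞∕N)² ≤ 1 + 4R₀²` on the support).  §2 **`windowedMass₂_blk_le`** = the engine's (M₂) letter for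
the block family, ANY `U`, ANY finite `W`, `S`, every centre: `≤ (1+4R₀²)·((2(ℓ₀+N))·((ℓ₀+N)·Σp))·e^{δR₀∕2}·(e^{δ∕2}(1+480e^{δ∕4}(4∕δ)⁴))` (pair weight by §1, reindex
`w ↦ b+w`, enlarge to `S.biUnion U` ∕ `S.biUnion (W.image (b+·))`, then `blk_windowedMass₂_le_half` BY NAME at `pos = strB = id`).  §3 **`coarse_mix4_secondMoment_blk`**
(the engine BY NAME at `qdd := ker₂ …`, abstract legs under (I₀)(J)(J′)) and the END **`mix4_rem_blockFamily`** (`I x u := J_m κI lI (N•u − x)` sup `C·N⁻¹`,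
`J b v := J_m κJ lJ (N•v − b)`, `J_m := N⁴•colOf(KPerf…)`, ONE `(κ₀, C)` ∀ m; `∃ κ₀ C` BEFORE `∀ m` and the block data).
NOT TYPED HERE: the identification with the road's (MIX-4) term (KER-γ (α)), the instance number (KER-γ (γ)), the four-direction sum ∕ (rem) packaging (LEDGER).
Provenance: cross-cell idle-seat kernel duty NE7b → β∕D1, unit `b2b-balaban-t4-ne7b-formalise-leaf-02` gen 23 (prover-…-leaf-02-g23-0), 2026-08-21, on leaf-01-g24's
shape (credited above) under R-FP-33 (c) «the remaining piece instances»; «not in print; our bookkeeping»; no existing file touched.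
-/

noncomputable section

namespace Summit.QuantumFields.BalabanUV.Beta.FP.MixLoopInstanceBlockFamilyQuartic

open Finset Real
open scoped BigOperators
open Literature.MathematicalPhysics.QuantumFieldTheory.Balaban1983to89
open Literature.MathematicalPhysics.QuantumFieldTheory.Balaban1983to89.Beta
open DyadicShell (Pt supNorm)
open BlockLegs (supNorm_sub_le_real)
open AxialBlockWeights (idx pt)
open Summit.QuantumFields.BalabanUV.Beta.GAN24.CombesThomas (sfStep smStep)
open Summit.QuantumFields.BalabanUV.Beta.FP.PerfectObjectsT (KPerf)
open Summit.QuantumFields.BalabanUV.Beta.FP.TransportInfinityM (colOf)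
open Summit.QuantumFields.BalabanUV.Beta.FP.AveragingJetLetters (mem_idx_iff)
open Summit.QuantumFields.BalabanUV.Beta.FP.AveragingJetLettersRooted (blkW blkFld blkBg blkW_nonneg)
open Summit.QuantumFields.BalabanUV.Beta.FP.AveragingJetLettersRootedSecond (ker₂ ker₂_nonneg exists_of_ker₂_ne_zero blk_windowedMass₂_le_half)
open Summit.QuantumFields.BalabanUV.Beta.FP.MixLoopPowerCounting (supNorm_cast_nonneg)
open Summit.QuantumFields.BalabanUV.Beta.FP.MixLoopPowerCountingMassQuartic (coarse_mix4_secondMoment_le)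
open Summit.QuantumFields.BalabanUV.Beta.FP.MixLoopInstanceBlockFamily (supNorm_pt_le_two_mul latticeColumn_engineLetters)

section Block

variable {σ : Type*} [Fintype σ] {N : ℕ} {μ : Fin 4} {p : σ → ℝ} {rad : σ → Pt → Pt → List Pt} {ℓ₀ R₀ : ℕ}

/-! ## §1 Pair support: both letters of a nonzero `ker₂` entry sit in one word of the block -/

omit [Fintype σ] in
/-- [folklore] **EVERY LETTER OF A WORD OF BLOCK `u` LIES WITHIN `R₀·N` OF THE ANCHOR** (point labels; radial letters by the displayed radius letter, straight
bonds by `‖pt μ q‖∞ ≤ 2N ≤ R₀N`). -/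
theorem mem_blkBg_local (hR₀ : 2 ≤ R₀)
    (hradR : ∀ (s : σ) (u : Pt) (q : ↥(idx N)) (ℓ : Pt), ℓ ∈ rad s u q.1.1 → supNorm (ℓ - (N : ℤ) • u) ≤ R₀ * N)
    {u ℓ : Pt} {e : ↥(idx N) × σ} (h : ℓ ∈ blkBg N μ u rad id e) : supNorm (ℓ - (N : ℤ) • u) ≤ R₀ * N := by
  unfold blkBg at h
  rcases List.mem_append.mp h with h | h
  · exact hradR e.2 u e.1 ℓ h
  · obtain ⟨j, hj, hjℓ⟩ := List.mem_map.mp h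
    have hj' : j < e.1.1.2 := List.mem_range.mp hj
    have hqj : (e.1.1.1, j) ∈ idx N := mem_idx_iff.mpr ⟨(mem_idx_iff.mp e.1.2).1, lt_trans hj' (mem_idx_iff.mp e.1.2).2⟩
    have hz : ℓ - (N : ℤ) • u = pt μ (e.1.1.1, j) := by rw [← hjℓ, id, ← natCast_zsmul u N]; abel
    rw [hz]
    calc supNorm (pt μ (e.1.1.1, j)) ≤ 2 * N := supNorm_pt_le_two_mul μ hqj
      _ ≤ R₀ * N := Nat.mul_le_mul_right N hR₀

/-- **PAIR SUPPORT** ([folklore]): a nonzero second-jet entry `ker₂^{(u)} b b′ c` puts BOTH background letters `b`, `b′` in one word of block `u`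
(`exists_of_ker₂_ne_zero`), hence both within `R₀·N` of the anchor `N•u`. -/
theorem blk_ker₂_pair_local (hR₀ : 2 ≤ R₀)
    (hradR : ∀ (s : σ) (u : Pt) (q : ↥(idx N)) (ℓ : Pt), ℓ ∈ rad s u q.1.1 → supNorm (ℓ - (N : ℤ) • u) ≤ R₀ * N)
    {u b b' c : Pt} (h : ker₂ (blkW N p) (blkFld N μ u) (blkBg N μ u rad id) b b' c ≠ 0) :
    supNorm (b - (N : ℤ) • u) ≤ R₀ * N ∧ supNorm (b' - (N : ℤ) • u) ≤ R₀ * N := by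
  obtain ⟨e, _, hb, hb'⟩ := exists_of_ker₂_ne_zero h
  exact ⟨mem_blkBg_local (μ := μ) hR₀ hradR hb, mem_blkBg_local (μ := μ) hR₀ hradR hb'⟩

/-- **THE PAIR WEIGHT IS PAID BY THE SUPPORT** ([folklore]): on the support of `ker₂^{(u)} b b′ ·`, `‖b′ − b‖∞ ≤ 2R₀N`, so `1 + (‖b′−b‖∞∕N)² ≤ 1 + 4R₀²` (`N ≥ 1`). -/
theorem pairWeight_le_of_ker₂_ne_zero (hN : 1 ≤ N) (hR₀ : 2 ≤ R₀)
    (hradR : ∀ (s : σ) (u : Pt) (q : ↥(idx N)) (ℓ : Pt), ℓ ∈ rad s u q.1.1 → supNorm (ℓ - (N : ℤ) • u) ≤ R₀ * N)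
    {u b b' c : Pt} (h : ker₂ (blkW N p) (blkFld N μ u) (blkBg N μ u rad id) b b' c ≠ 0) :
    1 + ((supNorm (b' - b) : ℝ) / N) ^ 2 ≤ 1 + 4 * (R₀ : ℝ) ^ 2 := by
  obtain ⟨hb, hb'⟩ := blk_ker₂_pair_local (μ := μ) (p := p) hR₀ hradR h
  have hn' : (0 : ℝ) < N := by exact_mod_cast hN
  have e : b' - b = (b' - (N : ℤ) • u) - (b - (N : ℤ) • u) := by abel
  have htri : (supNorm (b' - b) : ℝ) ≤ supNorm (b' - (N : ℤ) • u) + supNorm (b - (N : ℤ) • u) := by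
    rw [e]; exact supNorm_sub_le_real _ _
  have h1 : (supNorm (b - (N : ℤ) • u) : ℝ) ≤ (R₀ : ℝ) * N := by exact_mod_cast hb
  have h2 : (supNorm (b' - (N : ℤ) • u) : ℝ) ≤ (R₀ : ℝ) * N := by exact_mod_cast hb'
  have hsep : (supNorm (b' - b) : ℝ) / N ≤ 2 * R₀ := by
    rw [div_le_iff₀ hn']; linarith
  have h0 : 0 ≤ (supNorm (b' - b) : ℝ) / N := div_nonneg (supNorm_cast_nonneg _) hn'.le
  nlinarith

/-! ## §2 The engine's (M₂)-letter for the block family -/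

/-- **(M₂) FOR THE ENGINE's PAIR MASS AT THE BLOCK FAMILY** ([folklore]; ANY coarse windows `U b`, ALL finite `W`, `S`, every fine centre `c₀`):
`Σ_{b∈S}Σ_{b′∈S} e^{−(δ∕(2N))‖b−c₀‖∞}·(1 + (‖b′−b‖∞∕N)²)·(Σ_{u∈U b}Σ_{w∈W}|ker₂^{(u)} b b′ (b+w)|) ≤ (1+4R₀²)·((2(ℓ₀+N))·((ℓ₀+N)·Σ_σ p σ))·e^{δR₀∕2}·(e^{δ∕2}(1+480e^{δ∕4}(4∕δ)⁴))`
— the pair weight by `pairWeight_le_of_ker₂_ne_zero` termwise, reindex `w ↦ b + w`, enlarge the windows to `S.biUnion U` and `S.biUnion (W.image (b + ·))`, then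
`AveragingJetLettersRootedSecond.blk_windowedMass₂_le_half` BY NAME at `pos = strB = id`. -/
theorem windowedMass₂_blk_le {δ : ℝ} (hδ : 0 < δ) (hN : 1 ≤ N) (μ : Fin 4) (hp : ∀ s, 0 ≤ p s)
    (hrad : ∀ s u x', (rad s u x').length ≤ ℓ₀) (hR₀ : 2 ≤ R₀)
    (hradR : ∀ (s : σ) (u : Pt) (q : ↥(idx N)) (ℓ : Pt), ℓ ∈ rad s u q.1.1 → supNorm (ℓ - (N : ℤ) • u) ≤ R₀ * N)
    (U : Pt → Finset Pt) (W S : Finset Pt) (c₀ : Pt) :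
    ∑ b ∈ S, ∑ b' ∈ S, Real.exp (-(δ / (2 * N)) * (supNorm (b - c₀) : ℝ)) *
        (1 + ((supNorm (b' - b) : ℝ) / N) ^ 2) *
        (∑ u ∈ U b, ∑ w ∈ W, |ker₂ (blkW N p) (blkFld N μ u) (blkBg N μ u rad id) b b' (b + w)|)
      ≤ (1 + 4 * (R₀ : ℝ) ^ 2) * (((2 * ((ℓ₀ + N : ℕ) : ℝ)) * (((ℓ₀ + N : ℕ) : ℝ) * ∑ s, p s)) * Real.exp (δ * R₀ / 2) *
          (Real.exp (δ / 2) * (1 + 480 * Real.exp (δ / 4) * (4 / δ) ^ 4))) := by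
  classical
  have hω := blkW_nonneg N hp
  set Y : Finset Pt := S.biUnion U with hY
  set T : Finset Pt := S.biUnion fun b => W.image (fun w => b + w) with hT
  set K : Pt → Pt → Pt → Pt → ℝ := fun u b b' c => ker₂ (blkW N p) (blkFld N μ u) (blkBg N μ u rad id) b b' c with hK
  have hK0 : ∀ u b b' c, 0 ≤ K u b b' c := fun u b b' c => ker₂_nonneg hω _ _ _
  have hCR : (0 : ℝ) ≤ 1 + 4 * (R₀ : ℝ) ^ 2 := by positivity
  -- STEP 1: termwise, the pair weight is paid by the support
  have hterm : ∀ b b' u w, (1 + ((supNorm (b' - b) : ℝ) / N) ^ 2) * |K u b b' (b + w)| ≤ (1 + 4 * (R₀ : ℝ) ^ 2) * K u b b' (b + w) := by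
    intro b b' u w
    rw [abs_of_nonneg (hK0 u b b' (b + w))]
    by_cases h0 : K u b b' (b + w) = 0
    · rw [h0, mul_zero, mul_zero]
    · exact mul_le_mul_of_nonneg_right (pairWeight_le_of_ker₂_ne_zero (μ := μ) (p := p) hN hR₀ hradR h0) (hK0 u b b' (b + w))
  -- STEP 2: for fixed `b ∈ S`, the inner pair mass against the enlarged windows
  have hinner : ∀ b ∈ S, ∑ b' ∈ S, (1 + ((supNorm (b' - b) : ℝ) / N) ^ 2) * (∑ u ∈ U b, ∑ w ∈ W, |K u b b' (b + w)|)
      ≤ (1 + 4 * (R₀ : ℝ) ^ 2) * ∑ u ∈ Y, ∑ b' ∈ S, ∑ c ∈ T, K u b b' c := by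
    intro b hb
    have hUb : U b ⊆ Y := by rw [hY]; exact Finset.subset_biUnion_of_mem U hb
    have hWb : W.image (fun w => b + w) ⊆ T := by rw [hT]; exact Finset.subset_biUnion_of_mem (fun b => W.image (fun w => b + w)) hb
    calc ∑ b' ∈ S, (1 + ((supNorm (b' - b) : ℝ) / N) ^ 2) * (∑ u ∈ U b, ∑ w ∈ W, |K u b b' (b + w)|)
        = ∑ b' ∈ S, ∑ u ∈ U b, ∑ w ∈ W, (1 + ((supNorm (b' - b) : ℝ) / N) ^ 2) * |K u b b' (b + w)| := by
          refine Finset.sum_congr rfl fun b' _ => ?_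
          rw [Finset.mul_sum]
          exact Finset.sum_congr rfl fun u _ => Finset.mul_sum _ _ _
      _ ≤ ∑ b' ∈ S, ∑ u ∈ U b, ∑ w ∈ W, (1 + 4 * (R₀ : ℝ) ^ 2) * K u b b' (b + w) :=
          Finset.sum_le_sum fun b' _ => Finset.sum_le_sum fun u _ => Finset.sum_le_sum fun w _ => hterm b b' u w
      _ = (1 + 4 * (R₀ : ℝ) ^ 2) * ∑ u ∈ U b, ∑ b' ∈ S, ∑ w ∈ W, K u b b' (b + w) := by
          rw [Finset.sum_comm, Finset.mul_sum]
          refine Finset.sum_congr rfl fun u _ => ?_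
          rw [Finset.mul_sum]
          refine Finset.sum_congr rfl fun b' _ => ?_
          rw [Finset.mul_sum]
      _ ≤ (1 + 4 * (R₀ : ℝ) ^ 2) * ∑ u ∈ Y, ∑ b' ∈ S, ∑ c ∈ T, K u b b' c := by
          refine mul_le_mul_of_nonneg_left ?_ hCR
          calc ∑ u ∈ U b, ∑ b' ∈ S, ∑ w ∈ W, K u b b' (b + w)
              = ∑ u ∈ U b, ∑ b' ∈ S, ∑ c ∈ W.image (fun w => b + w), K u b b' c := by
                refine Finset.sum_congr rfl fun u _ => Finset.sum_congr rfl fun b' _ => ?_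
                rw [Finset.sum_image (fun x _ y _ h => add_left_cancel h)]
            _ ≤ ∑ u ∈ U b, ∑ b' ∈ S, ∑ c ∈ T, K u b b' c :=
                Finset.sum_le_sum fun u _ => Finset.sum_le_sum fun b' _ =>
                  Finset.sum_le_sum_of_subset_of_nonneg hWb fun c _ _ => hK0 u b b' c
            _ ≤ ∑ u ∈ Y, ∑ b' ∈ S, ∑ c ∈ T, K u b b' c :=
                Finset.sum_le_sum_of_subset_of_nonneg hUb fun u _ _ =>
                  Finset.sum_nonneg fun b' _ => Finset.sum_nonneg fun c _ => hK0 u b b' c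
  -- STEP 3: the windowed (M₂) letter BY NAME
  have hR₀' : (2 : ℝ) ≤ (R₀ : ℝ) := by exact_mod_cast hR₀
  have hradR' : ∀ (s : σ) (u : Pt) (q : ↥(idx N)) (ℓ : Pt), ℓ ∈ rad s u q.1.1 →
      (supNorm (id ℓ - (N : ℤ) • u) : ℝ) ≤ (R₀ : ℝ) * N := by
    intro s u q ℓ h
    have h' := hradR s u q ℓ h
    rw [id]
    exact_mod_cast h'
  have hM₂ := blk_windowedMass₂_le_half (B := Pt) (strB := id) hδ hN μ hp hrad id hR₀' (fun _ => rfl) hradR' S S T Y c₀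
  simp only [id] at hM₂
  calc ∑ b ∈ S, ∑ b' ∈ S, Real.exp (-(δ / (2 * N)) * (supNorm (b - c₀) : ℝ)) *
          (1 + ((supNorm (b' - b) : ℝ) / N) ^ 2) * (∑ u ∈ U b, ∑ w ∈ W, |K u b b' (b + w)|)
      = ∑ b ∈ S, Real.exp (-(δ / (2 * N)) * (supNorm (b - c₀) : ℝ)) *
          ∑ b' ∈ S, (1 + ((supNorm (b' - b) : ℝ) / N) ^ 2) * (∑ u ∈ U b, ∑ w ∈ W, |K u b b' (b + w)|) := by
        refine Finset.sum_congr rfl fun b _ => ?_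
        rw [Finset.mul_sum]
        exact Finset.sum_congr rfl fun b' _ => by ring
    _ ≤ ∑ b ∈ S, Real.exp (-(δ / (2 * N)) * (supNorm (b - c₀) : ℝ)) *
          ((1 + 4 * (R₀ : ℝ) ^ 2) * ∑ u ∈ Y, ∑ b' ∈ S, ∑ c ∈ T, K u b b' c) :=
        Finset.sum_le_sum fun b hb => mul_le_mul_of_nonneg_left (hinner b hb) (Real.exp_pos _).le
    _ = (1 + 4 * (R₀ : ℝ) ^ 2) * ∑ b ∈ S, Real.exp (-(δ / (2 * N)) * (supNorm (b - c₀) : ℝ)) *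
          ∑ u ∈ Y, ∑ b' ∈ S, ∑ c ∈ T, K u b b' c := by
        rw [Finset.mul_sum]
        exact Finset.sum_congr rfl fun b _ => by ring
    _ ≤ (1 + 4 * (R₀ : ℝ) ^ 2) * (((2 * ((ℓ₀ + N : ℕ) : ℝ)) * (((ℓ₀ + N : ℕ) : ℝ) * ∑ s, p s)) * Real.exp (δ * R₀ / 2) *
          (Real.exp (δ / 2) * (1 + 480 * Real.exp (δ / 4) * (4 / δ) ^ 4))) :=
        mul_le_mul_of_nonneg_left (by simpa only [hK] using hM₂) hCR

/-! ## §3 The engine at the block family and the END -/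

/-- **THE (MIX-4) ENGINE AT THE ROOTED BLOCK FAMILY, ABSTRACT LEGS** ([folklore] plumbing; `coarse_mix4_secondMoment_le` BY NAME at
`qdd u b b′ c := ker₂ (blkW N p) (blkFld N μ u) (blkBg N μ u rad id) b b′ c`, (M₂) := `windowedMass₂_blk_le` at the centre `N•v₀`): the engine carries NO window letter,
so `U b` and `W` are ARBITRARY; under (I₀) `|I c u| ≤ C_I`, (J) `|J b v₀| ≤ C_J e^{−(δ∕N)‖b−N•v₀‖∞}`, (J′) `Σ_{v∈V}(1+(‖b′−N•v‖∞∕N)²)|J b′ v| ≤ C_J′`: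
`Σ_{v∈V}‖v−v₀‖∞²·|Σ_{b,b′∈S} J b v₀·J b′ v·Σ_{u∈U b}Σ_{w∈W} ker₂^{(u)} b b′ (b+w)·I (b+w) u| ≤ 3·C_J·C_J′·(1+16∕δ²)·(C_I·A₂M)`,
`A₂M = (1+4R₀²)·((2(ℓ₀+N))·((ℓ₀+N)·Σp))·e^{δR₀∕2}·(e^{δ∕2}(1+480e^{δ∕4}(4∕δ)⁴))`. -/
theorem coarse_mix4_secondMoment_blk {δ : ℝ} (hδ : 0 < δ) (hN : 1 ≤ N) (μ : Fin 4) (hp : ∀ s, 0 ≤ p s)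
    (hrad : ∀ s u x', (rad s u x').length ≤ ℓ₀) (hR₀ : 2 ≤ R₀)
    (hradR : ∀ (s : σ) (u : Pt) (q : ↥(idx N)) (ℓ : Pt), ℓ ∈ rad s u q.1.1 → supNorm (ℓ - (N : ℤ) • u) ≤ R₀ * N)
    (U : Pt → Finset Pt) (W : Finset Pt) {I J : Pt → Pt → ℝ} {C_I C_J C_J' : ℝ} (hI : ∀ c u, |I c u| ≤ C_I)
    (S V : Finset Pt) (v₀ : Pt)
    (hJ : ∀ b, |J b v₀| ≤ C_J * Real.exp (-(δ / N) * (supNorm (b - (N : ℤ) • v₀) : ℝ)))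
    (hJ' : ∀ b', ∑ v ∈ V, (1 + ((supNorm (b' - (N : ℤ) • v) : ℝ) / N) ^ 2) * |J b' v| ≤ C_J') :
    ∑ v ∈ V, (supNorm (v - v₀) : ℝ) ^ 2 *
        |∑ b ∈ S, ∑ b' ∈ S, J b v₀ * J b' v *
          (∑ u ∈ U b, ∑ w ∈ W, ker₂ (blkW N p) (blkFld N μ u) (blkBg N μ u rad id) b b' (b + w) * I (b + w) u)|
      ≤ 3 * C_J * C_J' * (1 + 16 / δ ^ 2) *
        (C_I * ((1 + 4 * (R₀ : ℝ) ^ 2) * (((2 * ((ℓ₀ + N : ℕ) : ℝ)) * (((ℓ₀ + N : ℕ) : ℝ) * ∑ s, p s)) * Real.exp (δ * R₀ / 2) *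
          (Real.exp (δ / 2) * (1 + 480 * Real.exp (δ / 4) * (4 / δ) ^ 4))))) :=
  coarse_mix4_secondMoment_le (qdd := fun u b b' c => ker₂ (blkW N p) (blkFld N μ u) (blkBg N μ u rad id) b b' c) (U := U) (W := W)
    hδ hN hI S V v₀ hJ hJ' (windowedMass₂_blk_le hδ hN μ hp hrad hR₀ hradR U W S ((N : ℤ) • v₀))

end Block

section Columns

variable {Lc : ℕ} [NeZero Lc]

/-- **THE END `mix4_rem_blockFamily` — ROW RHOA-6e (INST-MIX4)** ([our object]; `d = 3`, `2 ≤ Lc`): there are `κ₀ > 0` and `C ≥ 0` (the perfect columns' letters,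
`MixLoopInstanceBlockFamily.latticeColumn_engineLetters`) such that for EVERY `m ≥ 1`, with `N = Lc^m` and `J_m = N⁴ • colOf (KPerf Lc (sfStep Lc) (smStep 3 Lc) m)`,
for every coarse direction `μ`, leg index pairs `(κI,lI)`, `(κJ,lJ)`, every rooted block family at blocking `N` (rules `σ`, probabilities `p σ ≥ 0`, radial words of length
`≤ ℓ₀` within `R₀·N` of the anchor, `2 ≤ R₀`), ARBITRARY coarse windows `U b`, every finite offset window `W`, all finite `S`, `V` and every `v₀` — with
`I x u := J_m κI lI (N•u − x)` (sup `C·N⁻¹`) and `J b v := J_m κJ lJ (N•v − b)`: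
`Σ_{v∈V}‖v−v₀‖∞²·|Σ_{b,b′∈S} J b v₀·J b′ v·Σ_{u∈U b}Σ_{w∈W} ker₂^{(u)} b b′ (b+w)·I (b+w) u|`
`≤ 3·(C·N⁻¹)·(C·N⁻¹·A(κ₀))·(1+16∕(κ₀∕4)²)·((C·N⁻¹)·((1+4R₀²)·((2(ℓ₀+N))·((ℓ₀+N)·Σp))·e^{(κ₀∕4)R₀∕2}·(e^{(κ₀∕4)∕2}(1+480e^{(κ₀∕4)∕4}(4∕(κ₀∕4))⁴))))` — EVERY power of `N`
displayed: `N⁻³·(ℓ₀+N)²·Σp` × m-free numbers (leaf-01-g24's hand count).  NOT the identification with the road's (MIX-4) term, NOT the four-direction sum, NOT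
`Mix_n = O(1)`, NOT hbook, NOT D1, NOT BetaPertH. -/
theorem mix4_rem_blockFamily (hLc : 2 ≤ Lc) :
    ∃ κ₀ C : ℝ, 0 < κ₀ ∧ 0 ≤ C ∧ ∀ m : ℕ, 1 ≤ m →
      ∀ {σ : Type*} [Fintype σ] (μ κI lI κJ lJ : Fin 4) {p : σ → ℝ} (_ : ∀ s, 0 ≤ p s)
        {rad : σ → Pt → Pt → List Pt} {ℓ₀ R₀ : ℕ} (_ : ∀ s u x', (rad s u x').length ≤ ℓ₀) (_ : 2 ≤ R₀)
        (_ : ∀ (s : σ) (u : Pt) (q : ↥(idx (Lc ^ m))) (ℓ : Pt), ℓ ∈ rad s u q.1.1 →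
          supNorm (ℓ - ((Lc ^ m : ℕ) : ℤ) • u) ≤ R₀ * Lc ^ m)
        (U : Pt → Finset Pt) (W S V : Finset Pt) (v₀ : Pt),
        ∑ v ∈ V, (supNorm (v - v₀) : ℝ) ^ 2 *
            |∑ b ∈ S, ∑ b' ∈ S,
              ((((Lc ^ m : ℕ) : ℝ) ^ 4) • colOf (KPerf (d := 3) Lc (sfStep Lc) (smStep 3 Lc) m)) κJ lJ (((Lc ^ m : ℕ) : ℤ) • v₀ - b) *
              ((((Lc ^ m : ℕ) : ℝ) ^ 4) • colOf (KPerf (d := 3) Lc (sfStep Lc) (smStep 3 Lc) m)) κJ lJ (((Lc ^ m : ℕ) : ℤ) • v - b') *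
              (∑ u ∈ U b, ∑ w ∈ W, ker₂ (blkW (Lc ^ m) p) (blkFld (Lc ^ m) μ u) (blkBg (Lc ^ m) μ u rad id) b b' (b + w) *
                ((((Lc ^ m : ℕ) : ℝ) ^ 4) • colOf (KPerf (d := 3) Lc (sfStep Lc) (smStep 3 Lc) m)) κI lI
                  (((Lc ^ m : ℕ) : ℤ) • u - (b + w)))|
          ≤ 3 * (C * (((Lc ^ m : ℕ) : ℝ))⁻¹)
              * (C * (((Lc ^ m : ℕ) : ℝ))⁻¹ * ((1 + 16 / (κ₀ / 4) ^ 2)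
                  * (Real.exp (κ₀ / 4 / 2) * (1 + 480 * Real.exp (κ₀ / 4 / 2 / 2) * (2 / (κ₀ / 4 / 2)) ^ 4))))
              * (1 + 16 / (κ₀ / 4) ^ 2) *
            (C * (((Lc ^ m : ℕ) : ℝ))⁻¹ *
              ((1 + 4 * (R₀ : ℝ) ^ 2) * (((2 * ((ℓ₀ + Lc ^ m : ℕ) : ℝ)) * (((ℓ₀ + Lc ^ m : ℕ) : ℝ) * ∑ s, p s)) *
                Real.exp ((κ₀ / 4) * R₀ / 2) * (Real.exp ((κ₀ / 4) / 2) * (1 + 480 * Real.exp ((κ₀ / 4) / 4) * (4 / (κ₀ / 4)) ^ 4))))) := by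
  obtain ⟨κ₀, C, hκ₀, hC, h⟩ := latticeColumn_engineLetters (Lc := Lc) hLc
  refine ⟨κ₀, C, hκ₀, hC, fun m hm σ _ μ κI lI κJ lJ p hp rad ℓ₀ R₀ hrad hR₀ hradR U W S V v₀ => ?_⟩
  have hN1 : 1 ≤ Lc ^ m := Nat.one_le_pow m Lc (le_trans (by norm_num) hLc)
  have hN : (0 : ℝ) < ((Lc ^ m : ℕ) : ℝ) := by exact_mod_cast hN1
  have hδ : 0 < κ₀ / 4 := by positivity
  -- (I₀): the columns' sup letter from the (I) letter with `e^{−…} ≤ 1`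
  have hI0 : ∀ x u : Pt,
      |((((Lc ^ m : ℕ) : ℝ) ^ 4) • colOf (KPerf (d := 3) Lc (sfStep Lc) (smStep 3 Lc) m)) κI lI (((Lc ^ m : ℕ) : ℤ) • u - x)|
        ≤ C * (((Lc ^ m : ℕ) : ℝ))⁻¹ := by
    intro x u
    refine (((h m hm κI lI).1 x u)).trans (mul_le_of_le_one_right (by positivity) (Real.exp_le_one_iff.mpr ?_))
    have hx := supNorm_cast_nonneg (x - ((Lc ^ m : ℕ) : ℤ) • u)
    have : 0 ≤ κ₀ / 4 / ((Lc ^ m : ℕ) : ℝ) * (supNorm (x - ((Lc ^ m : ℕ) : ℤ) • u) : ℝ) := by positivity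
    linarith
  exact coarse_mix4_secondMoment_blk (N := Lc ^ m) hδ hN1 μ hp hrad hR₀ hradR U W
    (I := fun x u => ((((Lc ^ m : ℕ) : ℝ) ^ 4) • colOf (KPerf (d := 3) Lc (sfStep Lc) (smStep 3 Lc) m)) κI lI
      (((Lc ^ m : ℕ) : ℤ) • u - x))
    (J := fun b v => ((((Lc ^ m : ℕ) : ℝ) ^ 4) • colOf (KPerf (d := 3) Lc (sfStep Lc) (smStep 3 Lc) m)) κJ lJ
      (((Lc ^ m : ℕ) : ℤ) • v - b))
    hI0 S V v₀ (fun b => (h m hm κJ lJ).1 b v₀) (fun b' => (h m hm κJ lJ).2 b' V)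

end Columns

end Summit.QuantumFields.BalabanUV.Beta.FP.MixLoopInstanceBlockFamilyQuartic

end
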